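import Mathlib
import Summits.QuantumFields.YangMills.Theorems.MagneticFluxCeilingCoulombCeilingStubSpectralFloorAtRate
import Literature.MathematicalPhysics.QuantumFieldTheory.AnisotropicTwistedPartitionFunction
import Literature.MathematicalPhysics.QuantumFieldTheory.YangMillsOS
import HarnessLib

/-!
# Route `MagneticFluxCeiling`, crux `AspectOnePurity` (stmt-QuantumFields-25308): the registered stub `stub_spectralGrowthFloor`

The BC3 birth skeleton of the crux (namespace `Summit.QuantumFields.YangMills.Theses.MagneticFluxCeilingBirthK2`, sha
`dcbf0359…`) registers `stub_spectralGrowthFloor : SpectralGrowthFloorP`: for `SU(N)`, `N ≥ 2`, `r`, `β > 0` and a spatial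
side `L ≥ 2` the untwisted Wilson partition function `Z(L³×M)` has a GROWTH RATE `λ₀(L) > 0`: `log Z(L³×M)/M → log λ₀` and
`λ₀^M ≤ Z(L³×M)` for `M ≥ 2`.  Proof: `λ₀` = the top level of the box transfer operator; the trace formula gives
`(m+2) log λ₀ ≤ log Z(L³×(m+2)) ≤ m log λ₀ + log Z(L³×2)` (`MagneticFluxCeiling.exists_log_bounds_twisted` at twist `1`,
`twistedPartitionFunctionAniso_one`), and the quotient by `m + 2` is squeezed to `log λ₀` (`tendsto_affine_div`).
Route-independent imports.  No summit is proved; the Yang–Mills mass gap is NOT proved.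
-/

noncomputable section

open MeasureTheory Filter Topology Function
open Literature.MathematicalPhysics.QuantumFieldTheory

namespace Summit.QuantumFields.YangMills.Theorems.MagneticFluxCeiling

/-- The registered stub's statement, letter for letter (birth skeleton of stmt-QuantumFields-25308, stub
`stub_spectralGrowthFloor : SpectralGrowthFloorP`). [problem-side] -/
def SpectralGrowthFloorP : Prop :=
  ∀ N : ℕ, 2 ≤ N → ∀ r : Literature.MathematicalPhysics.QuantumFieldTheory.LatticeRep (Matrix.specialUnitaryGroup (Fin N) ℂ), ∀ β : ℝ, 0 < β → ∀ L : ℕ, 2 ≤ L → ∃ lam : ℝ, 0 < lam ∧ Tendsto (fun M : ℕ => Real.log (Literature.MathematicalPhysics.QuantumFieldTheory.wilsonFinTorusPartition r.ρ β L L L M) / (M : ℝ)) atTop (𝓝 (Real.log lam)) ∧ ∀ M : ℕ, 2 ≤ M → lam ^ M ≤ Literature.MathematicalPhysics.QuantumFieldTheory.wilsonFinTorusPartition r.ρ β L L L M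

/-- **Registered stub `stub_spectralGrowthFloor` of the crux `AspectOnePurity` (stmt-QuantumFields-25308) — CLOSED.** [problem-side] -/
theorem stub_spectralGrowthFloor : SpectralGrowthFloorP := by
  intro N _ r β hβ L _
  set q₀ : {p : Fin 4 × Fin 4 // p.1 < p.2} := ⟨((0 : Fin 4), (1 : Fin 4)), by decide⟩ with hq₀
  have hρ := r.continuous
  have hρu := r.mem_unitary
  obtain ⟨lam₀, hlam, hb⟩ := exists_log_bounds_twisted r.ρ hρ hρu hβ.le (1 : Matrix.specialUnitaryGroup (Fin N) ℂ) L
  -- the untwisted member of the family is Wilson's partition function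
  have hZ1 : ∀ M : ℕ, twistedPartitionFunctionAniso r.ρ β L M 1 q₀ = wilsonFinTorusPartition r.ρ β L L L M := fun M =>
    twistedPartitionFunctionAniso_one r.ρ β L M q₀
  refine ⟨lam₀, hlam, ?_, fun M hM => ?_⟩
  · -- the rate: squeeze `log Z(m+2)/(m+2)` between `log λ₀` and `(m log λ₀ + log Z(2))/(m+2)`
    rw [← tendsto_add_atTop_iff_nat 2]
    have hupT := tendsto_affine_div (Real.log lam₀) (Real.log (wilsonFinTorusPartition r.ρ β L L L 2))
    refine tendsto_of_tendsto_of_tendsto_of_le_of_le tendsto_const_nhds hupT (fun m => ?_) (fun m => ?_)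
    · have hpos : (0 : ℝ) < (m : ℝ) + 2 := by positivity
      have hcast : (((m + 2 : ℕ) : ℝ)) = (m : ℝ) + 2 := by push_cast; ring
      simp only [hcast]
      rw [le_div_iff₀ hpos, ← hZ1]
      have := (hb m).1
      linarith
    · have hpos : (0 : ℝ) ≤ (m : ℝ) + 2 := by positivity
      have hcast : (((m + 2 : ℕ) : ℝ)) = (m : ℝ) + 2 := by push_cast; ring
      simp only [hcast]
      refine div_le_div_of_nonneg_right ?_ hpos
      rw [← hZ1, ← hZ1]
      have := (hb m).2
      linarith
  · -- the floor `λ₀^M ≤ Z(M)` for `M ≥ 2`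
    obtain ⟨m, rfl⟩ : ∃ m, M = m + 2 := ⟨M - 2, by omega⟩
    have hZpos : 0 < twistedPartitionFunctionAniso r.ρ β L (m + 2) 1 q₀ := twistedPartitionFunctionAniso_pos r.ρ hρ β L _ 1 q₀
    have h1 := (hb m).1
    have hcast : ((m : ℝ) + 2) * Real.log lam₀ = Real.log (lam₀ ^ (m + 2)) := by
      rw [Real.log_pow]; push_cast; ring
    rw [hcast] at h1
    rw [← hZ1]
    exact (Real.log_le_log_iff (pow_pos hlam _) hZpos).1 h1

end Summit.QuantumFields.YangMills.Theorems.MagneticFluxCeiling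

end
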